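import Summits.HodgeConjecture.HodgeConjecture.Theorems.F0P3LettersRouting        -- ★ p823358: letter #82 `CohClassRouting`, §1 transport `evpChoice_rep_cl`, §3 chain, §4 `routing_kitOfRecord` (v6 text, UNGUARDED)
import Summits.HodgeConjecture.HodgeConjecture.Theorems.F0P3ClassificationLawsV8    -- ★ V8-B: the GUARDED law text `F0P3InnerFormClassificationV8.ClassificationKit.Routing` (`IsCot P → KcTrivial P → …`)
import HarnessLib

/-!
# SIDECAR (J2) — law #15 `Routing` (★ V8 text, GUARDED) AT `𝔠₀` FROM THE GUARDED LETTER `CohClassRoutingCot` (typ-T2a (g0); kernel-checked TEXT for a prover's `Theorems/` file)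

Cell `hodgecm-mathlib`, F0∕P3 «U3-mult», crux H413 (`stmt-HodgeConjecture-24833`).  NOT a Lines file and NOT registered: this is the consumer junction (J2) of the T2 line
`F0/P3/Lines-draft/T2a_CohClassRoutingCotPaydown.lean` (ED. 5 bd0f8456da84a9ad, head `CohClassRoutingCot … := ∀ P, IsCot … P → ‹body of ★ CohClassRouting at P›`), written so that
a prover can lift it VERBATIM into `Summits/HodgeConjecture/HodgeConjecture/Theorems/F0P3RoutingOfCot.lean` (typers do not file under `Theorems/`), exactly as F0P3-p03 (g7) lifted
the local glue (★ p826873).  WHY IT IS NEEDED (read in the tree): ★ `F0P3LettersRouting.routing_kitOfRecord` (:303) and the ★ V8 family assembler's conjunct #15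
(`F0P3KitOfRecordLawsV8` :262 ff., via ★ `routing₈_kitOfRecord_of_v6` :174) consume the UNGUARDED letter ∕ v6 law text, whereas the law itself ★ V8 `Routing` (:183) is GUARDED
`∀ P, IsCot … P → KcTrivial … P → …` and ★ `laws₈_kitOfRecord_of₄` (:142) takes `h15` in that guarded text.  The ★ chain `clFinChoice_eq_πn_of_cohClassRouting` →
`cohClassRouting_eqOff` → `…_rep_cl` → `routing_kitOfRecord` uses the letter ONLY as `h P M σK σ𝔤 hM hirr htok δ hδ hne`, i.e. only through its conclusion AT `P`; this file
re-threads it PER `P` (hypothesis = the routing conclusion `∀ v ∉ S₁, ‹split clause› ∧ ‹non-split clause›` at `(P, ξ, S₁)`, VERBATIM the body of ★ `CohClassRouting`) and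
concludes the GUARDED V8 law at `𝔠₀ = kitOfRecord … (xiSideOfRecord …) …` from the guarded letter (`routing₈_kitOfRecord_of_cot`); the unguarded letter still feeds it
(`routing₈_kitOfRecord_of_cohClassRouting`, = ★ `routing₈_kitOfRecord_of_v6 (routing_kitOfRecord h)`).  Proofs = ★ p823358's, token for token after the first `obtain`.
(J1) (an assembler variant with conjunct #15 in the V8 text) and (J3) (K9β `StubL3 := CohClassRoutingCotClosed`, `intro P hP _` at §D) are the pen's; F0P3-plan rules guarded vs unguarded.
PROOF lane shape: theorems only, no `def`, no instance declaration (one LOCAL instance attribute = the ★ idiom), no notation, no `sorry`; `--supports stmt-HodgeConjecture-24833 --as helper`.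
HONEST LABEL: HC_CM is proved only modulo the printed citations until rung 0 closes; this file moves no letter.
-/

set_option autoImplicit false
set_option linter.dupNamespace false

noncomputable section

open NumberField IsDedekindDomain MeasureTheory
open Literature.NumberTheory.Rogawski1990 Literature.NumberTheory.GaloisRepresentations
open Literature.NumberTheory.Automorphic Literature.NumberTheory.Automorphic.UnitaryGroup
open Literature.RepresentationTheory.BorelWallach2000 Literature.RepresentationTheory.KonnoKonno2007
open scoped Matrix Classical

namespace Summit.HodgeConjecture.HodgeConjecture.Cruxes.H413.F0T2RoutingKitOfRecordOfCot

open Summit.HodgeConjecture.HodgeConjecture.Cruxes.H413.F0P3InnerFormClassificationV6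
open Summit.HodgeConjecture.HodgeConjecture.Cruxes.H413.F0P3KitOfRecord (kitOfRecord XiSide GHSide)
open Summit.HodgeConjecture.HodgeConjecture.Cruxes.H413.F0P3ClassTokensOfRecord (Cls cl rep)
open Summit.HodgeConjecture.HodgeConjecture.Cruxes.H413.F0P3ClassTokenChoice (clFinChoice evpChoice admUnitConstituents)
open Summit.HodgeConjecture.HodgeConjecture.Cruxes.H413.F0P3XiPacketFamilyOfRecord
open Summit.HodgeConjecture.HodgeConjecture.Cruxes.H413.F0P3XiSideOfRecord (xiSideOfRecord)
open Summit.HodgeConjecture.HodgeConjecture.Cruxes.H413.F0P3LettersRouting (CohClassRouting evpChoice_rep_cl routing_kitOfRecord)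

-- Mathlib idiom (as in ★ `F0P3LettersRouting`): commutator bracket on `Module.End`, needed to MENTION `(uFormGroup (Fin 2) (Fin 1)).lie →ₗ⁅ℝ⁆ Module.End ℂ M`
attribute [local instance 100] LieRing.ofAssociativeRing

variable (L : Type) [Field L] [NumberField L] [IsCMField L] (H : Matrix (Fin 3) (Fin 3) L)

variable (hH : (H.map (cmConjRingHom L))ᵀ = H) (hHd : IsUnit H.det) (μω : HeckeCharacter L) (hμu : μω.IsUnitary)
  [∀ v : HeightOneSpectrum (𝓞 ↥(maximalRealSubfield L)), MeasurableSpace (Gqs L v ⧸ Subgroup.center (Gqs L v))]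
  (μZ : ∀ v : HeightOneSpectrum (𝓞 ↥(maximalRealSubfield L)), Measure (Gqs L v ⧸ Subgroup.center (Gqs L v)))
  (keys : ∀ (ξ : OneDimAutRepH L) (v : HeightOneSpectrum (𝓞 ↥(maximalRealSubfield L))),
    (∀ w : PlacesOver L v, IsCMField.complexConj L • w.1 = w.1) →
      {p : IrrClass (Gqs L v) × IrrClass (Gqs L v) //
        KeysCaseTwoLabels L v (μω.semilocalComponent L v) (torusLocalComponent L (IsCMField.complexConj L) v ξ.η)
          (torusLocalComponent L (IsCMField.complexConj L) v ξ.ψ) p.1 p.2 ∧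
        p.1.IsSquareIntegrable (μZ v) ∧ ¬ p.2.IsSquareIntegrable (μZ v)})
  (ι : L →+* ℂ) (T : GL (Fin 3) ℂ)
  (hT : (T : Matrix (Fin 3) (Fin 3) ℂ)ᴴ * H.map ι * (T : Matrix (Fin 3) (Fin 3) ℂ) = Literature.Geometry.ComplexHyperbolic.BallModel.J)
  (μ : Measure (Gp L H).automorphicQuotient) [(Gp L H).IsAutomorphicMeasure μ]

/-! ## §1 The ★ p823358 chain re-threaded PER `P`: from the routing conclusion at `(P, ξ, S₁)` to the e.v.p. form at `rep (cl P)` -/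

section EvpForm

variable
  [∀ v : HeightOneSpectrum (𝓞 ↥(maximalRealSubfield L)),
    MeasurableSpace ((cmDatum L 2 (Matrix.of fun i j : Fin 2 => if i.val + j.val + 1 = 2 then (1 : L) else 0)).Local v ×
      (cmDatum L 1 (Matrix.of fun i j : Fin 1 => if i.val + j.val + 1 = 1 then (1 : L) else 0)).Local v)]
  [∀ (v : HeightOneSpectrum (𝓞 ↥(maximalRealSubfield L)))
      (a : ((cmDatum L 2 (Matrix.of fun i j : Fin 2 => if i.val + j.val + 1 = 2 then (1 : L) else 0)).Local v ×
        (cmDatum L 1 (Matrix.of fun i j : Fin 1 => if i.val + j.val + 1 = 1 then (1 : L) else 0)).Local v)),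
    MeasurableSpace (((cmDatum L 2 (Matrix.of fun i j : Fin 2 => if i.val + j.val + 1 = 2 then (1 : L) else 0)).Local v ×
        (cmDatum L 1 (Matrix.of fun i j : Fin 1 => if i.val + j.val + 1 = 1 then (1 : L) else 0)).Local v) ⧸
      Subgroup.centralizer ({a} : Set ((cmDatum L 2 (Matrix.of fun i j : Fin 2 => if i.val + j.val + 1 = 2 then (1 : L) else 0)).Local v ×
        (cmDatum L 1 (Matrix.of fun i j : Fin 1 => if i.val + j.val + 1 = 1 then (1 : L) else 0)).Local v)))]
  [∀ (v : HeightOneSpectrum (𝓞 ↥(maximalRealSubfield L))) (γ : (cmDatum L 3 H).Local v),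
    MeasurableSpace ((cmDatum L 3 H).Local v ⧸ Subgroup.centralizer ({γ} : Set ((cmDatum L 3 H).Local v)))]
  (Δ : ∀ v : HeightOneSpectrum (𝓞 ↥(maximalRealSubfield L)), LocalTransferFactor L H v)
  (mH : ∀ v : HeightOneSpectrum (𝓞 ↥(maximalRealSubfield L)),
    OrbitalMeasureFamily ((cmDatum L 2 (Matrix.of fun i j : Fin 2 => if i.val + j.val + 1 = 2 then (1 : L) else 0)).Local v ×
      (cmDatum L 1 (Matrix.of fun i j : Fin 1 => if i.val + j.val + 1 = 1 then (1 : L) else 0)).Local v))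
  (mG : ∀ v : HeightOneSpectrum (𝓞 ↥(maximalRealSubfield L)), letI : MeasurableSpace ((cmDatum L 3 H).Local v) := borel _; OrbitalMeasureFamily ((cmDatum L 3 H).Local v))
  (νG : ∀ v : HeightOneSpectrum (𝓞 ↥(maximalRealSubfield L)), @Measure ((cmDatum L 3 H).Local v) (borel _))
  (νH : ∀ v : HeightOneSpectrum (𝓞 ↥(maximalRealSubfield L)),
    Measure ((cmDatum L 2 (Matrix.of fun i j : Fin 2 => if i.val + j.val + 1 = 2 then (1 : L) else 0)).Local v ×
      (cmDatum L 1 (Matrix.of fun i j : Fin 1 => if i.val + j.val + 1 = 1 then (1 : L) else 0)).Local v))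
  (ξloc : OneDimAutRepH L → ∀ v : HeightOneSpectrum (𝓞 ↥(maximalRealSubfield L)),
    (cmDatum L 2 (Matrix.of fun i j : Fin 2 => if i.val + j.val + 1 = 2 then (1 : L) else 0)).Local v ×
      (cmDatum L 1 (Matrix.of fun i j : Fin 1 => if i.val + j.val + 1 = 1 then (1 : L) else 0)).Local v →* ℂˣ)
  (hCM : letI : ∀ v : HeightOneSpectrum (𝓞 ↥(maximalRealSubfield L)), MeasurableSpace ((cmDatum L 3 H).Local v) := fun _ => borel _
    ∀ (ξ : OneDimAutRepH L) (v : HeightOneSpectrum (𝓞 ↥(maximalRealSubfield L)))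
    (hns : ∀ w : PlacesOver L v, IsCMField.complexConj L • w.1 = w.1)
    (T : GL (Fin 3) (LocalRing L v)) (a : LocalRing L v) (ha : IsUnit a)
    (h : formCongr (conjLocal L (IsCMField.complexConj L) v) T (H.map (algebraMap L (LocalRing L v))) =
      a • (Matrix.of fun i j : Fin 3 => if i.val + j.val + 1 = 3 then (1 : L) else 0).map (algebraMap L (LocalRing L v)))
    (π2 πn : IrrClass (Gqs L v)),
    KeysCaseTwoLabels L v (μω.semilocalComponent L v) (torusLocalComponent L (IsCMField.complexConj L) v ξ.η)
      (torusLocalComponent L (IsCMField.complexConj L) v ξ.ψ) π2 πn → ¬ πn.IsSquareIntegrable (μZ v) →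
    CMNonsplitCharIdentityAt L v H (Δ v) (mH v) (mG v) (νG v) (νH v) (ξloc ξ v) (IrrClass.comap (cmDatumLocalCongr L v T ha h).symm πn))
  (hexc : ∀ ξ : OneDimAutRepH L, ∀ᶠ v : HeightOneSpectrum (𝓞 ↥(maximalRealSubfield L)) in Filter.cofinite,
      ∀ hns : ∀ w : PlacesOver L v, IsCMField.complexConj L • w.1 = w.1,
        ((keys ξ v hns).1.2).IsSpherical (cmLocalIntegralLevel L 3 (qsForm L) v))
  (μv : ∀ v : Places L, @Measure ((cmDatum L 3 H).Local v) (borel _))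

/-- **Routing to the packet OF RECORD off `S₁ ∪ ram₀ ξ`, PER `P`** (★ `clFinChoice_eq_πn_of_cohClassRouting` with the letter replaced by its conclusion at `(P, ξ, S₁)`):
`clFinChoice P v = (xiPacketFamilyOfRecord … ξ v).πn` for `v ∉ S₁ ∪ ramOfRecord₂ … ξ (hexc ξ)`. [cite: Rogawski1990, §13.1 p. 199; §12.2 (2) pp. 173–174] -/
theorem clFinChoice_eq_πn_of_routesOff (P : DiscreteAutomorphicRep (Gp L H) μ) (ξ : OneDimAutRepH L) (S₁ : Finset (Places L))
    (hS : ∀ v : Places L, v ∉ S₁ →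
      (∀ hs : ∃ w : PlacesOver L v, IsCMField.complexConj L • w.1 ≠ w.1,
          clFinChoice P v =
            (cmSplitPacket L H hH hHd v (splitWitness v hs) (splitWitness_spec v hs) (ξ.splitν₀ μω (splitWitness v hs).1)
              (ξ.locψ (splitWitness v hs).1) (ξ.norm_splitν₀_apply hμu (splitWitness v hs).1)
              (ξ.continuous_splitν₀ μω (splitWitness v hs).1) (ξ.norm_locψ_apply (splitWitness v hs).1)
              (ξ.continuous_locψ (splitWitness v hs).1)).πn) ∧
      (∀ hns : ∀ w : PlacesOver L v, IsCMField.complexConj L • w.1 = w.1,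
        ∀ (T : GL (Fin 3) (LocalRing L v)) (a : LocalRing L v) (ha : IsUnit a)
          (h : formCongr (conjLocal L (IsCMField.complexConj L) v) T (H.map (algebraMap L (LocalRing L v))) =
            a • (Matrix.of fun i j : Fin 3 => if i.val + j.val + 1 = 3 then (1 : L) else 0).map (algebraMap L (LocalRing L v))),
          (∀ g : (cmDatum L 3 H).Local v, (cmDatumLocalCongr L v T ha h).symm g ∈ cmLocalIntegralLevel L 3 (qsForm L) v ↔
            g ∈ cmLocalIntegralLevel L 3 H v) →
          clFinChoice P v = IrrClass.comap (cmDatumLocalCongr L v T ha h).symm (keys ξ v hns).1.2)) :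
    letI : ∀ v : HeightOneSpectrum (𝓞 ↥(maximalRealSubfield L)), MeasurableSpace ((cmDatum L 3 H).Local v) := fun _ => borel _
    ∀ v : Places L, v ∉ S₁ ∪ ramOfRecord₂ L H hH hHd μω μZ keys ξ (hexc ξ) →
      clFinChoice P v = (xiPacketFamilyOfRecord L H hH hHd μω hμu Δ mH mG νG νH ξloc μZ keys hCM ξ v).πn := by
  letI : ∀ v : HeightOneSpectrum (𝓞 ↥(maximalRealSubfield L)), MeasurableSpace ((cmDatum L 3 H).Local v) := fun _ => borel _
  intro v hv
  rw [Finset.mem_union, not_or] at hv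
  by_cases hs : ∃ w : PlacesOver L v, IsCMField.complexConj L • w.1 ≠ w.1
  · rw [xiPacketFamilyOfRecord_of_split L H hH hHd μω hμu Δ mH mG νG νH ξloc μZ keys hCM ξ v hs]
    exact (hS v hv.1).1 hs
  · have hns : ∀ w : PlacesOver L v, IsCMField.complexConj L • w.1 = w.1 := fun w => not_not.1 fun hw => hs ⟨w, hw⟩
    obtain ⟨T', a, ha, hT', hP, hlev⟩ := xiPacketFamilyOfRecord_of_nonsplit L H hH hHd μω hμu Δ mH mG νG νH ξloc μZ keys hCM ξ v hns
    have hgood := good_of_not_mem_ramOfRecord₂ L H hH hHd μω μZ keys ξ hv.2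
    rw [hP]
    exact (hS v hv.1).2 hns T' a ha hT' (hlev (hgood.2 hns).1)

include hexc in
/-- **The e.v.p. form at `P`, PER `P`** (★ `cohClassRouting_eqOff` re-threaded): `EqOff (S₁ ∪ ram₀ ξ) (evpChoice P · (μv ·)) (xiEvpOfRecord … μv ξ)`.
[cite: Rogawski1990, §15.3 ¶1 p. 244; §13.7 p. 206] [cite: CartierCorvallis1979, §IV.1 Cor. 4.1] -/
theorem eqOff_of_routesOff (P : DiscreteAutomorphicRep (Gp L H) μ) (ξ : OneDimAutRepH L) (S₁ : Finset (Places L))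
    (hS : ∀ v : Places L, v ∉ S₁ →
      (∀ hs : ∃ w : PlacesOver L v, IsCMField.complexConj L • w.1 ≠ w.1,
          clFinChoice P v =
            (cmSplitPacket L H hH hHd v (splitWitness v hs) (splitWitness_spec v hs) (ξ.splitν₀ μω (splitWitness v hs).1)
              (ξ.locψ (splitWitness v hs).1) (ξ.norm_splitν₀_apply hμu (splitWitness v hs).1)
              (ξ.continuous_splitν₀ μω (splitWitness v hs).1) (ξ.norm_locψ_apply (splitWitness v hs).1)
              (ξ.continuous_locψ (splitWitness v hs).1)).πn) ∧
      (∀ hns : ∀ w : PlacesOver L v, IsCMField.complexConj L • w.1 = w.1,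
        ∀ (T : GL (Fin 3) (LocalRing L v)) (a : LocalRing L v) (ha : IsUnit a)
          (h : formCongr (conjLocal L (IsCMField.complexConj L) v) T (H.map (algebraMap L (LocalRing L v))) =
            a • (Matrix.of fun i j : Fin 3 => if i.val + j.val + 1 = 3 then (1 : L) else 0).map (algebraMap L (LocalRing L v))),
          (∀ g : (cmDatum L 3 H).Local v, (cmDatumLocalCongr L v T ha h).symm g ∈ cmLocalIntegralLevel L 3 (qsForm L) v ↔
            g ∈ cmLocalIntegralLevel L 3 H v) →
          clFinChoice P v = IrrClass.comap (cmDatumLocalCongr L v T ha h).symm (keys ξ v hns).1.2)) :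
    letI : ∀ v : HeightOneSpectrum (𝓞 ↥(maximalRealSubfield L)), MeasurableSpace ((cmDatum L 3 H).Local v) := fun _ => borel _
    EqOff L H (S₁ ∪ ramOfRecord₂ L H hH hHd μω μZ keys ξ (hexc ξ)) (fun v => evpChoice P v (μv v))
      (xiEvpOfRecord L H hH hHd μω hμu Δ mH mG νG νH ξloc μZ keys hCM μv ξ) := by
  letI : ∀ v : HeightOneSpectrum (𝓞 ↥(maximalRealSubfield L)), MeasurableSpace ((cmDatum L 3 H).Local v) := fun _ => borel _
  intro v hv
  show evpChoice P v (μv v) = xiEvpOfRecord L H hH hHd μω hμu Δ mH mG νG νH ξloc μZ keys hCM μv ξ v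
  rw [xiEvpOfRecord_apply]
  unfold evpChoice
  rw [clFinChoice_eq_πn_of_routesOff L H hH hHd μω hμu μZ keys μ Δ mH mG νG νH ξloc hCM hexc P ξ S₁ hS v hv]

include hexc in
/-- **The same at the representative `rep (cl P)`** (★ `cohClassRouting_eqOff_rep_cl` re-threaded; the shape the kit law reads: `EqOff S (evp (cl P)) (tXi ξ)`).
[cite: Rogawski1990, §15.3 ¶1 p. 244] [cite: Dixmier1977, §13.1.3] -/
theorem eqOff_rep_cl_of_routesOff (P : DiscreteAutomorphicRep (Gp L H) μ) (ξ : OneDimAutRepH L) (S₁ : Finset (Places L))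
    (hS : ∀ v : Places L, v ∉ S₁ →
      (∀ hs : ∃ w : PlacesOver L v, IsCMField.complexConj L • w.1 ≠ w.1,
          clFinChoice P v =
            (cmSplitPacket L H hH hHd v (splitWitness v hs) (splitWitness_spec v hs) (ξ.splitν₀ μω (splitWitness v hs).1)
              (ξ.locψ (splitWitness v hs).1) (ξ.norm_splitν₀_apply hμu (splitWitness v hs).1)
              (ξ.continuous_splitν₀ μω (splitWitness v hs).1) (ξ.norm_locψ_apply (splitWitness v hs).1)
              (ξ.continuous_locψ (splitWitness v hs).1)).πn) ∧
      (∀ hns : ∀ w : PlacesOver L v, IsCMField.complexConj L • w.1 = w.1,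
        ∀ (T : GL (Fin 3) (LocalRing L v)) (a : LocalRing L v) (ha : IsUnit a)
          (h : formCongr (conjLocal L (IsCMField.complexConj L) v) T (H.map (algebraMap L (LocalRing L v))) =
            a • (Matrix.of fun i j : Fin 3 => if i.val + j.val + 1 = 3 then (1 : L) else 0).map (algebraMap L (LocalRing L v))),
          (∀ g : (cmDatum L 3 H).Local v, (cmDatumLocalCongr L v T ha h).symm g ∈ cmLocalIntegralLevel L 3 (qsForm L) v ↔
            g ∈ cmLocalIntegralLevel L 3 H v) →
          clFinChoice P v = IrrClass.comap (cmDatumLocalCongr L v T ha h).symm (keys ξ v hns).1.2)) :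
    letI : ∀ v : HeightOneSpectrum (𝓞 ↥(maximalRealSubfield L)), MeasurableSpace ((cmDatum L 3 H).Local v) := fun _ => borel _
    EqOff L H (S₁ ∪ ramOfRecord₂ L H hH hHd μω μZ keys ξ (hexc ξ)) (fun v => evpChoice (rep (Gp L H) μ (cl (Gp L H) μ P)) v (μv v))
      (xiEvpOfRecord L H hH hHd μω hμu Δ mH mG νG νH ξloc μZ keys hCM μv ξ) := by
  letI : ∀ v : HeightOneSpectrum (𝓞 ↥(maximalRealSubfield L)), MeasurableSpace ((cmDatum L 3 H).Local v) := fun _ => borel _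
  intro v hv
  exact (evpChoice_rep_cl P v (μv v)).trans (eqOff_of_routesOff L H hH hHd μω hμu μZ keys μ Δ mH mG νG νH ξloc hCM hexc μv P ξ S₁ hS v hv)

end EvpForm

/-! ## §2 GLUE: the GUARDED law `Routing` (★ V8 text) AT `𝔠₀` from the GUARDED letter, and from the unguarded letter -/

section Glue

variable
  [∀ v : HeightOneSpectrum (𝓞 ↥(maximalRealSubfield L)),
    MeasurableSpace ((cmDatum L 2 (Matrix.of fun i j : Fin 2 => if i.val + j.val + 1 = 2 then (1 : L) else 0)).Local v ×
      (cmDatum L 1 (Matrix.of fun i j : Fin 1 => if i.val + j.val + 1 = 1 then (1 : L) else 0)).Local v)]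
  [∀ (v : HeightOneSpectrum (𝓞 ↥(maximalRealSubfield L)))
      (a : ((cmDatum L 2 (Matrix.of fun i j : Fin 2 => if i.val + j.val + 1 = 2 then (1 : L) else 0)).Local v ×
        (cmDatum L 1 (Matrix.of fun i j : Fin 1 => if i.val + j.val + 1 = 1 then (1 : L) else 0)).Local v)),
    MeasurableSpace (((cmDatum L 2 (Matrix.of fun i j : Fin 2 => if i.val + j.val + 1 = 2 then (1 : L) else 0)).Local v ×
        (cmDatum L 1 (Matrix.of fun i j : Fin 1 => if i.val + j.val + 1 = 1 then (1 : L) else 0)).Local v) ⧸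
      Subgroup.centralizer ({a} : Set ((cmDatum L 2 (Matrix.of fun i j : Fin 2 => if i.val + j.val + 1 = 2 then (1 : L) else 0)).Local v ×
        (cmDatum L 1 (Matrix.of fun i j : Fin 1 => if i.val + j.val + 1 = 1 then (1 : L) else 0)).Local v)))]
  [∀ (v : HeightOneSpectrum (𝓞 ↥(maximalRealSubfield L))) (γ : (cmDatum L 3 H).Local v),
    MeasurableSpace ((cmDatum L 3 H).Local v ⧸ Subgroup.centralizer ({γ} : Set ((cmDatum L 3 H).Local v)))]
  (Δ : ∀ v : HeightOneSpectrum (𝓞 ↥(maximalRealSubfield L)), LocalTransferFactor L H v)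
  (mH : ∀ v : HeightOneSpectrum (𝓞 ↥(maximalRealSubfield L)),
    OrbitalMeasureFamily ((cmDatum L 2 (Matrix.of fun i j : Fin 2 => if i.val + j.val + 1 = 2 then (1 : L) else 0)).Local v ×
      (cmDatum L 1 (Matrix.of fun i j : Fin 1 => if i.val + j.val + 1 = 1 then (1 : L) else 0)).Local v))
  (mG : ∀ v : HeightOneSpectrum (𝓞 ↥(maximalRealSubfield L)), letI : MeasurableSpace ((cmDatum L 3 H).Local v) := borel _; OrbitalMeasureFamily ((cmDatum L 3 H).Local v))
  (νG : ∀ v : HeightOneSpectrum (𝓞 ↥(maximalRealSubfield L)), @Measure ((cmDatum L 3 H).Local v) (borel _))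
  (νH : ∀ v : HeightOneSpectrum (𝓞 ↥(maximalRealSubfield L)),
    Measure ((cmDatum L 2 (Matrix.of fun i j : Fin 2 => if i.val + j.val + 1 = 2 then (1 : L) else 0)).Local v ×
      (cmDatum L 1 (Matrix.of fun i j : Fin 1 => if i.val + j.val + 1 = 1 then (1 : L) else 0)).Local v))
  (ξloc : OneDimAutRepH L → ∀ v : HeightOneSpectrum (𝓞 ↥(maximalRealSubfield L)),
    (cmDatum L 2 (Matrix.of fun i j : Fin 2 => if i.val + j.val + 1 = 2 then (1 : L) else 0)).Local v ×
      (cmDatum L 1 (Matrix.of fun i j : Fin 1 => if i.val + j.val + 1 = 1 then (1 : L) else 0)).Local v →* ℂˣ)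
  (hCM : letI : ∀ v : HeightOneSpectrum (𝓞 ↥(maximalRealSubfield L)), MeasurableSpace ((cmDatum L 3 H).Local v) := fun _ => borel _
    ∀ (ξ : OneDimAutRepH L) (v : HeightOneSpectrum (𝓞 ↥(maximalRealSubfield L)))
    (hns : ∀ w : PlacesOver L v, IsCMField.complexConj L • w.1 = w.1)
    (T : GL (Fin 3) (LocalRing L v)) (a : LocalRing L v) (ha : IsUnit a)
    (h : formCongr (conjLocal L (IsCMField.complexConj L) v) T (H.map (algebraMap L (LocalRing L v))) =
      a • (Matrix.of fun i j : Fin 3 => if i.val + j.val + 1 = 3 then (1 : L) else 0).map (algebraMap L (LocalRing L v)))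
    (π2 πn : IrrClass (Gqs L v)),
    KeysCaseTwoLabels L v (μω.semilocalComponent L v) (torusLocalComponent L (IsCMField.complexConj L) v ξ.η)
      (torusLocalComponent L (IsCMField.complexConj L) v ξ.ψ) π2 πn → ¬ πn.IsSquareIntegrable (μZ v) →
    CMNonsplitCharIdentityAt L v H (Δ v) (mH v) (mG v) (νG v) (νH v) (ξloc ξ v) (IrrClass.comap (cmDatumLocalCongr L v T ha h).symm πn))
  (hexc : ∀ ξ : OneDimAutRepH L, ∀ᶠ v : HeightOneSpectrum (𝓞 ↥(maximalRealSubfield L)) in Filter.cofinite,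
      ∀ hns : ∀ w : PlacesOver L v, IsCMField.complexConj L • w.1 = w.1,
        ((keys ξ v hns).1.2).IsSpherical (cmLocalIntegralLevel L 3 (qsForm L) v))
  (μv : ∀ v : Places L, @Measure ((cmDatum L 3 H).Local v) (borel _))
  [MeasurableSpace (Gp L H).Adelic] [BorelSpace (Gp L H).Adelic]
  (𝔰 : Sockets L H μ) (gh : GHSide L H ι T hT 𝔰.PacketG 𝔰.PacketH)
  (evpG' : 𝔰.PacketG → EvpData L H) (evpH' : 𝔰.PacketH → EvpData L H) (ramG' : 𝔰.PacketG → Finset (Places L)) (ramH' : 𝔰.PacketH → Finset (Places L))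
  (PiXi' : OneDimAutRepH L → 𝔰.PacketG) (ρXi' : OneDimAutRepH L → 𝔰.PacketH)
  (c : ℚ) (jInf dsInf : ℤ → ℤ → ℤ → Cinf)
  (archTr : Cinf → (UnitaryGroup.arch (↥(maximalRealSubfield L)) L (IsCMField.complexConj L) 3 H → ℂ) → ℂ)
  (ν : Measure (Gp L H).Adelic) [IsFiniteMeasureOnCompacts ν]
  (ramCls₀ : DiscreteAutomorphicRep (Gp L H) μ → Set (Places L))

/-- **(J2) Row #15 — the GUARDED law `Routing` (★ V8 text `IsCot P → KcTrivial P → …`) AT `𝔠₀` FROM THE GUARDED LETTER** `CohClassRoutingCot` (its text spelled out as the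
hypothesis `h`: `∀ P, IsCot … P → ‹body of ★ CohClassRouting at P›`; the T2 line's `CohClassRoutingCot L H hH hHd μω hμu μZ keys ι T hT μ` IS this text with the two clauses
abbreviated `RoutesAt`, definitionally).  The kit reads `evp (cl P) v = evpChoice (rep (cl P)) v (μv v)` and `tXi = xiEvpOfRecord … μv` (`rfl`, as in ★ `routing_kitOfRecord`).
[cite: Rogawski1990, §15.3 ¶1 p. 244; §13.3 Thm. 13.3.6 (c) p. 202] -/
theorem routing₈_kitOfRecord_of_cot
    (h : ∀ (P : DiscreteAutomorphicRep (Gp L H) μ), IsCot L H ι T hT μ P → ∀ (M : Type) [AddCommGroup M] [Module ℂ M]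
      (σK : Representation ℂ (uFormGroup (Fin 2) (Fin 1)).maximalCompact M) (σ𝔤 : (uFormGroup (Fin 2) (Fin 1)).lie →ₗ⁅ℝ⁆ Module.End ℂ M)
      (hM : IsGKModule (uFormGroup (Fin 2) (Fin 1)) σK σ𝔤), IsIrreducibleGK σK σ𝔤 → HasToken L H ι T hT μ P M σK σ𝔤 →
      ∀ δ : ℤ, (δ = 1 ∨ δ = -1) → upqTypeClasses σK σ𝔤 hM.ad_compat 1 δ ≠ ⊥ →
        ∃ (ξ : OneDimAutRepH L) (S₁ : Finset (Places L)), ∀ v : Places L, v ∉ S₁ →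
          (∀ hs : ∃ w : PlacesOver L v, IsCMField.complexConj L • w.1 ≠ w.1,
              clFinChoice P v =
                (cmSplitPacket L H hH hHd v (splitWitness v hs) (splitWitness_spec v hs) (ξ.splitν₀ μω (splitWitness v hs).1)
                  (ξ.locψ (splitWitness v hs).1) (ξ.norm_splitν₀_apply hμu (splitWitness v hs).1)
                  (ξ.continuous_splitν₀ μω (splitWitness v hs).1) (ξ.norm_locψ_apply (splitWitness v hs).1)
                  (ξ.continuous_locψ (splitWitness v hs).1)).πn) ∧
          (∀ hns : ∀ w : PlacesOver L v, IsCMField.complexConj L • w.1 = w.1,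
            ∀ (T : GL (Fin 3) (LocalRing L v)) (a : LocalRing L v) (ha : IsUnit a)
              (h : formCongr (conjLocal L (IsCMField.complexConj L) v) T (H.map (algebraMap L (LocalRing L v))) =
                a • (Matrix.of fun i j : Fin 3 => if i.val + j.val + 1 = 3 then (1 : L) else 0).map (algebraMap L (LocalRing L v))),
              (∀ g : (cmDatum L 3 H).Local v, (cmDatumLocalCongr L v T ha h).symm g ∈ cmLocalIntegralLevel L 3 (qsForm L) v ↔
                g ∈ cmLocalIntegralLevel L 3 H v) →
              clFinChoice P v = IrrClass.comap (cmDatumLocalCongr L v T ha h).symm (keys ξ v hns).1.2)) :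
    F0P3InnerFormClassificationV8.ClassificationKit.Routing
      (kitOfRecord L H ι T hT μ 𝔰 gh
        (xiSideOfRecord L H hH hHd μω hμu Δ mH mG νG νH ξloc μZ keys hCM hexc μv evpG' evpH' ramG' ramH' PiXi' ρXi')
        μω c jInf dsInf archTr ν μv ramCls₀) := by
  intro P hP _ M _ _ σK σ𝔤 hM hirr htok δ hδ hne
  letI : ∀ v : HeightOneSpectrum (𝓞 ↥(maximalRealSubfield L)), MeasurableSpace ((cmDatum L 3 H).Local v) := fun _ => borel _
  obtain ⟨ξ, S₁, hS⟩ := h P hP M σK σ𝔤 hM hirr htok δ hδ hne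
  exact ⟨ξ, S₁ ∪ ramOfRecord₂ L H hH hHd μω μZ keys ξ (hexc ξ),
    eqOff_rep_cl_of_routesOff L H hH hHd μω hμu μZ keys μ Δ mH mG νG νH ξloc hCM hexc μv P ξ S₁ hS⟩

/-- **Compatibility**: the UNGUARDED letter ★ `CohClassRouting` feeds the guarded V8 law at `𝔠₀` too (a fortiori; = ★ `routing₈_kitOfRecord_of_v6 (routing_kitOfRecord h)`).
[cite: Rogawski1990, §15.3 ¶1 p. 244] -/
theorem routing₈_kitOfRecord_of_cohClassRouting (h : CohClassRouting L H hH hHd μω hμu μZ keys ι T hT μ) :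
    F0P3InnerFormClassificationV8.ClassificationKit.Routing
      (kitOfRecord L H ι T hT μ 𝔰 gh
        (xiSideOfRecord L H hH hHd μω hμu Δ mH mG νG νH ξloc μZ keys hCM hexc μv evpG' evpH' ramG' ramH' PiXi' ρXi')
        μω c jInf dsInf archTr ν μv ramCls₀) :=
  routing₈_kitOfRecord_of_cot L H hH hHd μω hμu μZ keys ι T hT μ Δ mH mG νG νH ξloc hCM hexc μv 𝔰 gh evpG' evpH' ramG' ramH' PiXi' ρXi' c jInf dsInf
    archTr ν ramCls₀ (fun P _ M _ _ σK σ𝔤 hM hirr htok δ hδ hne => h P M σK σ𝔤 hM hirr htok δ hδ hne)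

end Glue

end Summit.HodgeConjecture.HodgeConjecture.Cruxes.H413.F0T2RoutingKitOfRecordOfCot

end
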